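import Mathlib.Algebra.GroupWithZero.Associated
import Mathlib.RingTheory.Ideal.Span
import HarnessLib

/-!
# [OURS · L1 W4.5(b) · S6 (N3) POINTS CASE, ring brick (R3)] A non-unit divisor of a prime power is divisible by the prime

Cell res-hironaka, LADDER-RESOLUTION rung L, slot W4.5(b), crux chain w45b: EL♮(3) = stmt-ResolutionOfSingularities-20148, S6 (N3)+(N3′)
POINTS CASE in the local currency (res-L1-w45b-stub-4 g8, THE CUT 2026-08-27T22:08:10Z: ring bricks (R1)+(R2) res-type-100, **(R3) res-D-pv-036**;
support step (ii) of the scheme spine (S3): at a point of the exceptional divisor the stalk generator `w` is prime in the UFD `𝒪_{X₂,x′}`, and a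
non-unit local equation dividing a power of `w` is divisible by `w`). By-signature; `--supports stmt-ResolutionOfSingularities-20148 --as helper`.
NOT a statement of any manuscript; OURS; AI-written, weaker than expert review. Definition-free; Mathlib-only; standard axioms.

* `mem_span_singleton_of_dvd_pow_of_prime` — (R3) VERBATIM: `R` a domain, `w` prime, `f` a non-unit with `f ∣ wⁿ` ⇒ `w ∣ f` (Mathlib
  `dvd_prime_pow`: `f ~ wⁱ` with `i ≤ n`, and `i ≠ 0` because `f` is not a unit).
* `mem_span_singleton_of_dvd_pow_of_prime'` — the same concluded as `f ∈ Ideal.span {w}`.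
* `not_dvd_pow_of_not_dvd` — (R3′) the contrapositive packaging: `w ∤ f`, `f` a non-unit ⇒ `∀ n, ¬ f ∣ wⁿ`; and
  `pow_not_mem_span_singleton_of_not_dvd` — `wⁿ ∉ Ideal.span {f}`.
[folklore]
-/

set_option linter.dupNamespace false

namespace Summit.ResolutionOfSingularities.ResolutionOfSingularities.Cruxes.EquisingularLiftNat.Sections

variable {R : Type*} [CommRing R] [IsDomain R]

/-- **(R3) A non-unit divisor of a prime power is divisible by the prime**: `w` prime, `f` not a unit, `f ∣ wⁿ` ⇒ `w ∣ f`
(`f` is associated to some `wⁱ`, `i ≤ n`, and `i ≥ 1` since `f` is not a unit). [folklore] -/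
theorem mem_span_singleton_of_dvd_pow_of_prime {w f : R} (hw : Prime w) (hf : ¬ IsUnit f) (n : ℕ) (h : f ∣ w ^ n) : w ∣ f := by
  obtain ⟨i, -, hi⟩ := (dvd_prime_pow hw n).mp h
  rcases Nat.eq_zero_or_pos i with h0 | hpos
  · rw [h0, pow_zero] at hi
    exact absurd (isUnit_of_dvd_one hi.dvd) hf
  · obtain ⟨k, rfl⟩ : ∃ k, i = k + 1 := ⟨i - 1, by omega⟩
    exact (Dvd.intro _ (pow_succ' w k).symm).trans hi.symm.dvd

/-- (R3), ideal spelling: `f ∈ (w)` for a non-unit `f` dividing a power of the prime `w`. [folklore] -/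
theorem mem_span_singleton_of_dvd_pow_of_prime' {w f : R} (hw : Prime w) (hf : ¬ IsUnit f) (n : ℕ) (h : f ∣ w ^ n) :
    f ∈ Ideal.span ({w} : Set R) :=
  Ideal.mem_span_singleton.mpr (mem_span_singleton_of_dvd_pow_of_prime hw hf n h)

/-- **(R3′) contrapositive packaging**: `w` prime, `w ∤ f`, `f` not a unit ⇒ `f` divides NO power of `w`. [folklore] -/
theorem not_dvd_pow_of_not_dvd {w f : R} (hw : Prime w) (hf : ¬ IsUnit f) (hwf : ¬ w ∣ f) (n : ℕ) : ¬ f ∣ w ^ n :=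
  fun h => hwf (mem_span_singleton_of_dvd_pow_of_prime hw hf n h)

/-- (R3′), ideal spelling: `w ∤ f`, `f` not a unit ⇒ `wⁿ ∉ (f)`. [folklore] -/
theorem pow_not_mem_span_singleton_of_not_dvd {w f : R} (hw : Prime w) (hf : ¬ IsUnit f) (hwf : ¬ w ∣ f) (n : ℕ) :
    w ^ n ∉ Ideal.span ({f} : Set R) :=
  fun h => not_dvd_pow_of_not_dvd hw hf hwf n (Ideal.mem_span_singleton.mp h)

end Summit.ResolutionOfSingularities.ResolutionOfSingularities.Cruxes.EquisingularLiftNat.Sections
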